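import Literature.Analysis.FunctionSpaces.LatticeConvolutionAlgebra
import HarnessLib

/-!
# Periodic differential operators of order `≤ 2` on the lattice Sobolev scale (Warner 6.24–6.25)

Continuation of `LatticeConvolution*.lean`. F. W. Warner (GTM 94 (1983), 6.24) calls a
*periodic differential operator of order `l`* on `ℂ^m`-valued periodic functions a matrix of
operators `∑_{[α] ≤ l} a_α D^α` with smooth periodic coefficients; Prop. 6.25: it is bounded
`H_{s+l} → H_s` for every `s`. On the Fourier side such an operator is a finite combination of
convolutions by the (rapidly decreasing) coefficient families `â_α` and of the derivative
multipliers `∂_j ↔ 2πi k_j`. This file fixes the **order `≤ 2`** case in the normal form needed by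
the elliptic estimates (Warner 6.29, second step: "the constant coefficient operator `L₀`
determined by the highest-order part of `L` at `p`" plus a perturbation):

  `L u = ∑_{i,j} A_{ij} ∂_i∂_j u + ∑_{i,j} b_{ij} ⋆ ∂_i∂_j u + ∑_j c_j ⋆ ∂_j u + c₀ ⋆ u`

(`Lattice.POp`: constant principal coefficients `A_{ij} : V →L[ℂ] W`, rapidly decreasing
symbols `b_{ij}`, `c_j`, `c₀`), together with

* `Lattice.POp.apply` and its value on tempered families;
* **boundedness `H_{s+2} → H_s`** with an explicit finite constant (`Lattice.POp.eNorm_apply_le`,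
  Warner 6.25 (2));
* the order-one operators `Lattice.POp1` (`P u = ∑_j (P_j + p_j ⋆) ∂_j u + p₀ ⋆ u`), bounded
  `H_{s+1} → H_s` (`Lattice.POp1.eNorm_apply_le`).

Composition of two order-one operators, formal adjoints and the elliptic estimate are in the
sequel files.

## References

* F. W. Warner, *Foundations of Differentiable Manifolds and Lie Groups*, GTM 94 (1983), 6.24,
  Prop. 6.25, 6.29. [WarnerGTM94]
-/

open Filter Finset
open scoped ENNReal NNReal Topology

noncomputable section

namespace Literature.Analysis.FunctionSpaces

namespace Lattice

open Torus

variable {d : Type*} [Fintype d]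
variable {V W : Type*} [NormedAddCommGroup V] [NormedSpace ℂ V] [NormedAddCommGroup W]
  [NormedSpace ℂ W]

/-! ### Pointwise constant maps -/

/-- A constant coefficient acts pointwise; its norm on `H_s`: `‖T ∘ c‖_s ≤ ‖T‖ ‖c‖_s`. [folklore] -/
theorem eNorm_comp_apply_le (s : ℝ) (T : V →L[ℂ] W) (c : (d → ℤ) → V) :
    eNorm s (fun k => T (c k)) ≤ ‖T‖ₑ * eNorm s c := by
  rw [← ofReal_norm]
  simpa using eNorm_le_of_norm_le (norm_nonneg T) (s := s) (t := 0) (c := c) (c' := fun k => T (c k))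
    (fun k => by simpa using T.le_opNorm (c k))

/-- `‖T ∘ c‖²_s ≤ ‖T‖² ‖c‖²_s`. [folklore] -/
theorem eNormSq_comp_apply_le (s : ℝ) (T : V →L[ℂ] W) (c : (d → ℤ) → V) :
    eNormSq s (fun k => T (c k)) ≤ ‖T‖ₑ ^ 2 * eNormSq s c := by
  have h := eNorm_comp_apply_le s T c
  rw [← eNorm_pow_two, ← eNorm_pow_two]
  calc eNorm s (fun k => T (c k)) ^ 2 ≤ (‖T‖ₑ * eNorm s c) ^ 2 := by gcongr
    _ = _ := mul_pow _ _ _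

omit [NormedSpace ℂ V] [NormedSpace ℂ W] in
/-- Tempered families are mapped to tempered families by pointwise constant maps. [folklore] -/
theorem Tempered.comp_apply [NormedSpace ℂ V] [NormedSpace ℂ W] (T : V →L[ℂ] W) {c : (d → ℤ) → V}
    (hc : Tempered c) : Tempered (fun k => T (c k)) := by
  obtain ⟨s, hs⟩ := hc
  exact ⟨s, (eNormSq_comp_apply_le s T c).trans_lt (ENNReal.mul_lt_top (ENNReal.pow_lt_top enorm_lt_top) hs)⟩

/-- `‖∂_i ∂_j u‖_s ≤ (2π)² ‖u‖_{s+2}`. [cite: WarnerGTM94, 6.18 (h)] -/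
theorem eNorm_freqDeriv_freqDeriv_le (s : ℝ) (i j : d) (u : (d → ℤ) → V) :
    eNorm s (freqDeriv i (freqDeriv j u)) ≤ ENNReal.ofReal ((2 * Real.pi) ^ 2) * eNorm (s + 2) u := by
  calc eNorm s (freqDeriv i (freqDeriv j u)) ≤ ENNReal.ofReal (2 * Real.pi) * eNorm (s + 1) (freqDeriv j u) :=
        eNorm_freqDeriv_le s i _
    _ ≤ ENNReal.ofReal (2 * Real.pi) * (ENNReal.ofReal (2 * Real.pi) * eNorm (s + 1 + 1) u) := by
        gcongr; exact eNorm_freqDeriv_le (s + 1) j u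
    _ = _ := by
        rw [← mul_assoc, ← ENNReal.ofReal_mul (by positivity), ← sq, add_assoc]; norm_num

/-- Second derivatives of tempered families are tempered. [folklore] -/
theorem Tempered.freqDeriv_freqDeriv {u : (d → ℤ) → V} (hu : Tempered u) (i j : d) :
    Tempered (Lattice.freqDeriv i (Lattice.freqDeriv j u)) :=
  (hu.freqDeriv j).freqDeriv i

omit [NormedSpace ℂ V] in
/-- Finite sums of tempered families are tempered. [folklore] -/
theorem Tempered.finset_sum {ι : Type*} (F : Finset ι) {c : ι → (d → ℤ) → V}
    (h : ∀ i ∈ F, Tempered (c i)) : Tempered (∑ i ∈ F, c i) := by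
  classical
  induction F using Finset.induction_on with
  | empty => simpa using tempered_zero
  | insert i F hi ih =>
      rw [sum_insert hi]
      exact (h i (mem_insert_self i F)).add (ih fun k hk => h k (mem_insert_of_mem hk))

/-! ### Order-two operators in normal form -/

variable (d V W) in
/-- **A periodic differential operator of order `≤ 2`, Fourier side, in perturbative normal form**
(Warner (1983), 6.24 with the decomposition of 6.29/6.31: frozen principal part + perturbation):
`L u = ∑_{i,j} A_{ij} ∂_i∂_j u + ∑_{i,j} b_{ij} ⋆ ∂_i∂_j u + ∑_j c_j ⋆ ∂_j u + c₀ ⋆ u` with constant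
principal coefficients `A_{ij}`, and rapidly decreasing symbols (Fourier coefficients of smooth
periodic matrix functions) `b_{ij}` (principal perturbation), `c_j`, `c₀`.
[cite: WarnerGTM94, 6.24] -/
structure POp where
  /-- frozen principal coefficients `A_{ij}` -/
  A : d → d → (V →L[ℂ] W)
  /-- principal perturbation symbols `b_{ij}` -/
  b : d → d → (d → ℤ) → (V →L[ℂ] W)
  /-- first-order symbols `c_j` -/
  c1 : d → (d → ℤ) → (V →L[ℂ] W)
  /-- zeroth-order symbol `c₀` -/
  c0 : (d → ℤ) → (V →L[ℂ] W)
  /-- the perturbation symbols are rapidly decreasing -/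
  hb : ∀ i j, RapidDecay (b i j)
  /-- the first-order symbols are rapidly decreasing -/
  hc1 : ∀ j, RapidDecay (c1 j)
  /-- the zeroth-order symbol is rapidly decreasing -/
  hc0 : RapidDecay c0

namespace POp

variable (L : POp d V W)

/-- The frozen principal part `L₀ u = ∑_{i,j} A_{ij} ∂_i ∂_j u` (a pure multiplier,
`(L₀u)_k = -4π² ∑ k_i k_j A_{ij} u_k`). [cite: WarnerGTM94, 6.29] -/
def principal (u : (d → ℤ) → V) : (d → ℤ) → W := fun k => ∑ i, ∑ j, L.A i j (freqDeriv i (freqDeriv j u) k)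

/-- The perturbation and lower-order part `∑ b_{ij} ⋆ ∂_i∂_j u + ∑ c_j ⋆ ∂_j u + c₀ ⋆ u`.
[cite: WarnerGTM94, 6.24] -/
def lower (u : (d → ℤ) → V) : (d → ℤ) → W :=
  ∑ i, ∑ j, conv (L.b i j) (freqDeriv i (freqDeriv j u)) + ∑ j, conv (L.c1 j) (freqDeriv j u) + conv L.c0 u

/-- **The action** `L u = L₀ u + (∑ b_{ij} ⋆ ∂_i∂_j u + ∑ c_j ⋆ ∂_j u + c₀ ⋆ u)`.
[cite: WarnerGTM94, 6.24 (2)] -/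
def apply (u : (d → ℤ) → V) : (d → ℤ) → W := L.principal u + L.lower u

/-- Unfolding of `lower` (use this lemma rather than definitional unfolding: unifying the two sides
by lazy delta-reduction is prohibitively slow). [folklore] -/
theorem lower_def (u : (d → ℤ) → V) : L.lower u =
    ∑ i, ∑ j, conv (L.b i j) (freqDeriv i (freqDeriv j u)) + ∑ j, conv (L.c1 j) (freqDeriv j u) + conv L.c0 u := by
  unfold POp.lower
  rfl

/-- Unfolding of `apply`. [folklore] -/
theorem apply_def (u : (d → ℤ) → V) : L.apply u = L.principal u + L.lower u := rfl

/-- Unfolding of the principal part at a frequency: `(L₀u)_k = ∑ (2πi k_i)(2πi k_j) A_{ij} u_k`.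
[folklore] -/
theorem principal_apply (u : (d → ℤ) → V) (k : d → ℤ) :
    L.principal u k = ∑ i, ∑ j, ((2 * Real.pi * Complex.I * (k i)) * (2 * Real.pi * Complex.I * (k j))) •
      L.A i j (u k) := by
  simp only [principal, freqDeriv_apply, map_smul, smul_smul]

/-- The principal part of a tempered family is tempered. [folklore] -/
theorem tempered_principal {u : (d → ℤ) → V} (hu : Tempered u) : Tempered (L.principal u) := by
  have : L.principal u = ∑ i, ∑ j, fun k => L.A i j (freqDeriv i (freqDeriv j u) k) := by
    funext k; simp [principal, Finset.sum_apply]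
  rw [this]
  exact Tempered.finset_sum _ fun i _ => Tempered.finset_sum _ fun j _ =>
    (hu.freqDeriv_freqDeriv i j).comp_apply (L.A i j)

variable [CompleteSpace W]

omit [CompleteSpace W] in
/-- The lower part of a tempered family is tempered. [folklore] -/
theorem tempered_lower {u : (d → ℤ) → V} (hu : Tempered u) : Tempered (L.lower u) := by
  rw [lower_def]
  exact ((Tempered.finset_sum _ fun i _ => Tempered.finset_sum _ fun j _ =>
    (hu.freqDeriv_freqDeriv i j).conv (L.hb i j)).add
    (Tempered.finset_sum _ fun j _ => (hu.freqDeriv j).conv (L.hc1 j))).add (hu.conv L.hc0)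

omit [CompleteSpace W] in
/-- **`L` maps tempered families to tempered families** (`L : H_{-∞} → H_{-∞}`).
[cite: WarnerGTM94, 6.25] -/
theorem tempered_apply {u : (d → ℤ) → V} (hu : Tempered u) : Tempered (L.apply u) :=
  (L.tempered_principal hu).add (L.tempered_lower hu)

omit [CompleteSpace W] in
/-- **Bound for the principal part**: `‖L₀ u‖_s ≤ (2π)² (∑ ‖A_{ij}‖) ‖u‖_{s+2}`.
[cite: WarnerGTM94, 6.25 (1)] -/
theorem eNorm_principal_le (s : ℝ) (u : (d → ℤ) → V) :
    eNorm s (L.principal u) ≤ ENNReal.ofReal ((2 * Real.pi) ^ 2) * (∑ i, ∑ j, ‖L.A i j‖ₑ) * eNorm (s + 2) u := by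
  have heq : L.principal u = ∑ i, ∑ j, fun k => L.A i j (freqDeriv i (freqDeriv j u) k) := by
    funext k; simp [principal, Finset.sum_apply]
  have hT : ∀ i j, eNorm s (fun k => L.A i j (freqDeriv i (freqDeriv j u) k)) ≤
      ‖L.A i j‖ₑ * (ENNReal.ofReal ((2 * Real.pi) ^ 2) * eNorm (s + 2) u) := fun i j =>
    (eNorm_comp_apply_le s _ _).trans (mul_le_mul' le_rfl (eNorm_freqDeriv_freqDeriv_le s i j u))
  calc eNorm s (L.principal u) ≤ ∑ i, ∑ j, ‖L.A i j‖ₑ * (ENNReal.ofReal ((2 * Real.pi) ^ 2) * eNorm (s + 2) u) := by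
        rw [heq]
        refine (eNorm_sum_le s _ _).trans (Finset.sum_le_sum fun i _ => ?_)
        exact (eNorm_sum_le s _ _).trans (Finset.sum_le_sum fun j _ => hT i j)
    _ = ENNReal.ofReal ((2 * Real.pi) ^ 2) * (∑ i, ∑ j, ‖L.A i j‖ₑ) * eNorm (s + 2) u := by
        rw [Finset.mul_sum, Finset.sum_mul]
        refine Finset.sum_congr rfl fun i _ => ?_
        rw [Finset.mul_sum, Finset.sum_mul]
        exact Finset.sum_congr rfl fun j _ => by ring

/-- The constant of the lower part on `H_s`:
`2^{|s|/2} ((2π)² ∑ A_{|s|}(b_{ij}) + 2π ∑ A_{|s|}(c_j) + A_{|s|}(c₀))`. [cite: WarnerGTM94, 6.25] -/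
def lowerBound (s : ℝ) : ℝ≥0∞ :=
  ENNReal.ofReal ((2 : ℝ) ^ (|s| / 2)) *
    (ENNReal.ofReal ((2 * Real.pi) ^ 2) * ∑ i, ∑ j, symbNorm |s| (L.b i j) +
      ENNReal.ofReal (2 * Real.pi) * ∑ j, symbNorm |s| (L.c1 j) + symbNorm |s| L.c0)

omit [CompleteSpace W] in
/-- The constant of the lower part is finite. [folklore] -/
theorem lowerBound_lt_top (s : ℝ) : L.lowerBound s < ∞ := by
  refine ENNReal.mul_lt_top ENNReal.ofReal_lt_top (ENNReal.add_lt_top.2 ⟨ENNReal.add_lt_top.2 ⟨?_, ?_⟩, ?_⟩)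
  · exact ENNReal.mul_lt_top ENNReal.ofReal_lt_top (ENNReal.sum_lt_top.2 fun i _ =>
      ENNReal.sum_lt_top.2 fun j _ => symbNorm_lt_top_of_rapidDecay (L.hb i j) _)
  · exact ENNReal.mul_lt_top ENNReal.ofReal_lt_top (ENNReal.sum_lt_top.2 fun j _ =>
      symbNorm_lt_top_of_rapidDecay (L.hc1 j) _)
  · exact symbNorm_lt_top_of_rapidDecay L.hc0 _

omit [CompleteSpace W] in
/-- **Bound for the lower part**: `‖∑ b_{ij} ⋆ ∂_i∂_j u + ∑ c_j ⋆ ∂_j u + c₀ ⋆ u‖_s ≤ K_s ‖u‖_{s+2}`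
with `K_s = lowerBound s` (Warner 6.25 (1), each term by 6.18 (h), (i)).
[cite: WarnerGTM94, 6.25 (1)] -/
theorem eNorm_lower_le (s : ℝ) (u : (d → ℤ) → V) :
    eNorm s (L.lower u) ≤ L.lowerBound s * eNorm (s + 2) u := by
  have h0 : eNorm s u ≤ eNorm (s + 2) u := eNorm_mono (by linarith) u
  have h1 : eNorm (s + 1) u ≤ eNorm (s + 2) u := eNorm_mono (by linarith) u
  have hB : ∀ i j, eNorm s (conv (L.b i j) (freqDeriv i (freqDeriv j u))) ≤ symbNorm |s| (L.b i j) *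
      (ENNReal.ofReal ((2 : ℝ) ^ (|s| / 2)) * ENNReal.ofReal ((2 * Real.pi) ^ 2) * eNorm (s + 2) u) :=
    fun i j => by
    calc eNorm s (conv (L.b i j) (freqDeriv i (freqDeriv j u)))
        ≤ ENNReal.ofReal ((2 : ℝ) ^ (|s| / 2)) * symbNorm |s| (L.b i j) * eNorm s (freqDeriv i (freqDeriv j u)) :=
          eNorm_conv_le s _ _
      _ ≤ ENNReal.ofReal ((2 : ℝ) ^ (|s| / 2)) * symbNorm |s| (L.b i j) *
            (ENNReal.ofReal ((2 * Real.pi) ^ 2) * eNorm (s + 2) u) :=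
          mul_le_mul' le_rfl (eNorm_freqDeriv_freqDeriv_le s i j u)
      _ = _ := by ring
  have hC : ∀ j, eNorm s (conv (L.c1 j) (freqDeriv j u)) ≤ symbNorm |s| (L.c1 j) *
      (ENNReal.ofReal ((2 : ℝ) ^ (|s| / 2)) * ENNReal.ofReal (2 * Real.pi) * eNorm (s + 2) u) := fun j => by
    calc eNorm s (conv (L.c1 j) (freqDeriv j u))
        ≤ ENNReal.ofReal ((2 : ℝ) ^ (|s| / 2)) * symbNorm |s| (L.c1 j) * eNorm s (freqDeriv j u) :=
          eNorm_conv_le s _ _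
      _ ≤ ENNReal.ofReal ((2 : ℝ) ^ (|s| / 2)) * symbNorm |s| (L.c1 j) *
            (ENNReal.ofReal (2 * Real.pi) * eNorm (s + 2) u) :=
          mul_le_mul' le_rfl ((eNorm_freqDeriv_le s j u).trans (mul_le_mul' le_rfl h1))
      _ = _ := by ring
  have hD : eNorm s (conv L.c0 u) ≤ symbNorm |s| L.c0 * (ENNReal.ofReal ((2 : ℝ) ^ (|s| / 2)) * eNorm (s + 2) u) := by
    calc eNorm s (conv L.c0 u) ≤ ENNReal.ofReal ((2 : ℝ) ^ (|s| / 2)) * symbNorm |s| L.c0 * eNorm s u :=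
          eNorm_conv_le s _ _
      _ ≤ ENNReal.ofReal ((2 : ℝ) ^ (|s| / 2)) * symbNorm |s| L.c0 * eNorm (s + 2) u := mul_le_mul' le_rfl h0
      _ = _ := by ring
  have hB' : eNorm s (∑ i, ∑ j, conv (L.b i j) (freqDeriv i (freqDeriv j u))) ≤
      (∑ i, ∑ j, symbNorm |s| (L.b i j)) *
        (ENNReal.ofReal ((2 : ℝ) ^ (|s| / 2)) * ENNReal.ofReal ((2 * Real.pi) ^ 2) * eNorm (s + 2) u) := by
    rw [Finset.sum_mul]
    refine (eNorm_sum_le s _ _).trans (Finset.sum_le_sum fun i _ => ?_)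
    rw [Finset.sum_mul]
    exact (eNorm_sum_le s _ _).trans (Finset.sum_le_sum fun j _ => hB i j)
  have hC' : eNorm s (∑ j, conv (L.c1 j) (freqDeriv j u)) ≤ (∑ j, symbNorm |s| (L.c1 j)) *
      (ENNReal.ofReal ((2 : ℝ) ^ (|s| / 2)) * ENNReal.ofReal (2 * Real.pi) * eNorm (s + 2) u) := by
    rw [Finset.sum_mul]
    exact (eNorm_sum_le s _ _).trans (Finset.sum_le_sum fun j _ => hC j)
  have hsplit : eNorm s (L.lower u) ≤ eNorm s (∑ i, ∑ j, conv (L.b i j) (freqDeriv i (freqDeriv j u))) +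
      eNorm s (∑ j, conv (L.c1 j) (freqDeriv j u)) + eNorm s (conv L.c0 u) :=
    calc eNorm s (L.lower u) = eNorm s (∑ i, ∑ j, conv (L.b i j) (freqDeriv i (freqDeriv j u)) +
          ∑ j, conv (L.c1 j) (freqDeriv j u) + conv L.c0 u) := by rw [lower_def]
      _ ≤ _ := (eNorm_add_le s _ (conv L.c0 u)).trans (add_le_add (eNorm_add_le s _ _) le_rfl)
  refine hsplit.trans ((add_le_add (add_le_add hB' hC') hD).trans (le_of_eq ?_))
  rw [lowerBound]
  ring

/-- The full constant `(2π)² ∑‖A_{ij}‖ + K_s`. [cite: WarnerGTM94, 6.25] -/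
def bound (s : ℝ) : ℝ≥0∞ := ENNReal.ofReal ((2 * Real.pi) ^ 2) * (∑ i, ∑ j, ‖L.A i j‖ₑ) + L.lowerBound s

omit [CompleteSpace W] in
/-- The full constant is finite. [folklore] -/
theorem bound_lt_top (s : ℝ) : L.bound s < ∞ :=
  ENNReal.add_lt_top.2 ⟨ENNReal.mul_lt_top ENNReal.ofReal_lt_top
    (ENNReal.sum_lt_top.2 fun _ _ => ENNReal.sum_lt_top.2 fun _ _ => enorm_lt_top), L.lowerBound_lt_top s⟩

omit [CompleteSpace W] in
/-- **Warner's Proposition 6.25 (order 2)**: a periodic differential operator of order `2` is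
bounded `H_{s+2} → H_s` for every real `s`: `‖L u‖_s ≤ C_s ‖u‖_{s+2}` with the finite constant
`C_s = L.bound s`. [cite: WarnerGTM94, Prop. 6.25 (2)] -/
theorem eNorm_apply_le (s : ℝ) (u : (d → ℤ) → V) : eNorm s (L.apply u) ≤ L.bound s * eNorm (s + 2) u :=
  calc eNorm s (L.apply u) ≤ eNorm s (L.principal u) + eNorm s (L.lower u) := eNorm_add_le s _ _
    _ ≤ ENNReal.ofReal ((2 * Real.pi) ^ 2) * (∑ i, ∑ j, ‖L.A i j‖ₑ) * eNorm (s + 2) u +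
          L.lowerBound s * eNorm (s + 2) u := add_le_add (L.eNorm_principal_le s u) (L.eNorm_lower_le s u)
    _ = L.bound s * eNorm (s + 2) u := by rw [bound, add_mul]

omit [CompleteSpace W] in
/-- `L u ∈ H_s` for `u ∈ H_{s+2}`. [cite: WarnerGTM94, Prop. 6.25 (2)] -/
theorem eNormSq_apply_lt_top {s : ℝ} {u : (d → ℤ) → V} (hu : eNormSq (s + 2) u < ∞) :
    eNormSq s (L.apply u) < ∞ := by
  rw [← eNorm_lt_top_iff] at hu ⊢
  exact (L.eNorm_apply_le s u).trans_lt (ENNReal.mul_lt_top (L.bound_lt_top s) hu)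

/-! ### Linearity on tempered families -/

/-- `L (u + v) = L u + L v` for tempered `u, v`. [folklore] -/
theorem apply_add {u v : (d → ℤ) → V} (hu : Tempered u) (hv : Tempered v) :
    L.apply (u + v) = L.apply u + L.apply v := by
  have hp : L.principal (u + v) = L.principal u + L.principal v := by
    funext k
    simp only [principal, Pi.add_apply, freqDeriv_add, map_add, Finset.sum_add_distrib]
  have hl : L.lower (u + v) = L.lower u + L.lower v := by
    rw [lower_def, lower_def, lower_def]
    simp only [freqDeriv_add]
    rw [conv_add L.hc0 hu hv]
    have h1 : ∀ j, conv (L.c1 j) (freqDeriv j u + freqDeriv j v) =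
        conv (L.c1 j) (freqDeriv j u) + conv (L.c1 j) (freqDeriv j v) := fun j =>
      conv_add (L.hc1 j) (hu.freqDeriv j) (hv.freqDeriv j)
    have h2 : ∀ i j, conv (L.b i j) (freqDeriv i (freqDeriv j u) + freqDeriv i (freqDeriv j v)) =
        conv (L.b i j) (freqDeriv i (freqDeriv j u)) + conv (L.b i j) (freqDeriv i (freqDeriv j v)) :=
      fun i j => conv_add (L.hb i j) (hu.freqDeriv_freqDeriv i j) (hv.freqDeriv_freqDeriv i j)
    simp only [h1, h2, Finset.sum_add_distrib]
    abel
  rw [apply_def, apply_def, apply_def, hp, hl]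
  abel

omit [CompleteSpace W] in
/-- `L (z • u) = z • L u` (unconditionally). [folklore] -/
theorem apply_smul (z : ℂ) (u : (d → ℤ) → V) : L.apply (z • u) = z • L.apply u := by
  have hp : L.principal (z • u) = z • L.principal u := by
    funext k
    simp only [principal, Pi.smul_apply, freqDeriv_const_smul, map_smul, Finset.smul_sum]
  have hl : L.lower (z • u) = z • L.lower u := by
    rw [lower_def, lower_def]
    simp only [freqDeriv_const_smul, conv_const_smul, smul_add, Finset.smul_sum]
  rw [apply_def, apply_def, hp, hl, smul_add]

/-- `L (u - v) = L u - L v` for tempered `u, v`. [folklore] -/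
theorem apply_sub {u v : (d → ℤ) → V} (hu : Tempered u) (hv : Tempered v) :
    L.apply (u - v) = L.apply u - L.apply v := by
  rw [sub_eq_add_neg, L.apply_add hu hv.neg, show -v = (-1 : ℂ) • v by simp, L.apply_smul]
  simp [sub_eq_add_neg]

end POp

/-! ### Order-one operators -/

variable (d V W) in
/-- **A periodic differential operator of order `≤ 1`, Fourier side**:
`P u = ∑_j (P_j + p_j ⋆) ∂_j u + p₀ ⋆ u` with constant principal coefficients `P_j` and rapidly
decreasing symbols `p_j` (principal perturbation), `p₀` (Warner 6.24 with `l = 1`).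
[cite: WarnerGTM94, 6.24] -/
structure POp1 where
  /-- frozen principal coefficients `P_j` -/
  P : d → (V →L[ℂ] W)
  /-- principal perturbation symbols `p_j` -/
  p : d → (d → ℤ) → (V →L[ℂ] W)
  /-- zeroth-order symbol `p₀` -/
  p0 : (d → ℤ) → (V →L[ℂ] W)
  /-- the perturbation symbols are rapidly decreasing -/
  hp : ∀ j, RapidDecay (p j)
  /-- the zeroth-order symbol is rapidly decreasing -/
  hp0 : RapidDecay p0

namespace POp1

variable (P : POp1 d V W)

/-- **The action** `P u = ∑_j P_j ∂_j u + ∑_j p_j ⋆ ∂_j u + p₀ ⋆ u`. [cite: WarnerGTM94, 6.24 (2)] -/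
def apply (u : (d → ℤ) → V) : (d → ℤ) → W :=
  (fun k => ∑ j, P.P j (freqDeriv j u k)) + ∑ j, conv (P.p j) (freqDeriv j u) + conv P.p0 u

/-- Unfolding of `apply` (use this lemma rather than definitional unfolding). [folklore] -/
theorem apply_def (u : (d → ℤ) → V) :
    P.apply u = (fun k => ∑ j, P.P j (freqDeriv j u k)) + ∑ j, conv (P.p j) (freqDeriv j u) + conv P.p0 u := by
  unfold POp1.apply
  rfl

variable [CompleteSpace W]

omit [CompleteSpace W] in
/-- `P` maps tempered families to tempered families. [cite: WarnerGTM94, 6.25] -/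
theorem tempered_apply {u : (d → ℤ) → V} (hu : Tempered u) : Tempered (P.apply u) := by
  rw [apply_def]
  have h1 : Tempered (fun k => ∑ j, P.P j (freqDeriv j u k)) := by
    have : (fun k => ∑ j, P.P j (freqDeriv j u k)) = ∑ j, fun k => P.P j (freqDeriv j u k) := by
      funext k; simp [Finset.sum_apply]
    rw [this]
    exact Tempered.finset_sum _ fun j _ => (hu.freqDeriv j).comp_apply (P.P j)
  exact (h1.add (Tempered.finset_sum _ fun j _ => (hu.freqDeriv j).conv (P.hp j))).add (hu.conv P.hp0)

/-- The constant of `P` on `H_s`: `2π ∑ ‖P_j‖ + 2^{|s|/2}(2π ∑ A_{|s|}(p_j) + A_{|s|}(p₀))`.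
[cite: WarnerGTM94, 6.25] -/
def bound (s : ℝ) : ℝ≥0∞ :=
  ENNReal.ofReal (2 * Real.pi) * (∑ j, ‖P.P j‖ₑ) +
    ENNReal.ofReal ((2 : ℝ) ^ (|s| / 2)) * (ENNReal.ofReal (2 * Real.pi) * ∑ j, symbNorm |s| (P.p j) + symbNorm |s| P.p0)

omit [CompleteSpace W] in
/-- The constant is finite. [folklore] -/
theorem bound_lt_top (s : ℝ) : P.bound s < ∞ := by
  refine ENNReal.add_lt_top.2 ⟨ENNReal.mul_lt_top ENNReal.ofReal_lt_top
    (ENNReal.sum_lt_top.2 fun j _ => enorm_lt_top), ENNReal.mul_lt_top ENNReal.ofReal_lt_top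
      (ENNReal.add_lt_top.2 ⟨?_, symbNorm_lt_top_of_rapidDecay P.hp0 _⟩)⟩
  exact ENNReal.mul_lt_top ENNReal.ofReal_lt_top (ENNReal.sum_lt_top.2 fun j _ =>
    symbNorm_lt_top_of_rapidDecay (P.hp j) _)

omit [CompleteSpace W] in
/-- **Warner's Proposition 6.25 (order 1)**: `‖P u‖_s ≤ C_s ‖u‖_{s+1}`, `C_s = P.bound s`.
[cite: WarnerGTM94, Prop. 6.25 (2)] -/
theorem eNorm_apply_le (s : ℝ) (u : (d → ℤ) → V) : eNorm s (P.apply u) ≤ P.bound s * eNorm (s + 1) u := by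
  have h0 : eNorm s u ≤ eNorm (s + 1) u := eNorm_mono (by linarith) u
  have hA : ∀ j, eNorm s (fun k => P.P j (freqDeriv j u k)) ≤
      ‖P.P j‖ₑ * (ENNReal.ofReal (2 * Real.pi) * eNorm (s + 1) u) := fun j =>
    (eNorm_comp_apply_le s _ _).trans (mul_le_mul' le_rfl (eNorm_freqDeriv_le s j u))
  have hB : ∀ j, eNorm s (conv (P.p j) (freqDeriv j u)) ≤ symbNorm |s| (P.p j) *
      (ENNReal.ofReal ((2 : ℝ) ^ (|s| / 2)) * ENNReal.ofReal (2 * Real.pi) * eNorm (s + 1) u) := fun j => by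
    calc eNorm s (conv (P.p j) (freqDeriv j u))
        ≤ ENNReal.ofReal ((2 : ℝ) ^ (|s| / 2)) * symbNorm |s| (P.p j) * eNorm s (freqDeriv j u) :=
          eNorm_conv_le s _ _
      _ ≤ ENNReal.ofReal ((2 : ℝ) ^ (|s| / 2)) * symbNorm |s| (P.p j) *
            (ENNReal.ofReal (2 * Real.pi) * eNorm (s + 1) u) := mul_le_mul' le_rfl (eNorm_freqDeriv_le s j u)
      _ = _ := by ring
  have hC : eNorm s (conv P.p0 u) ≤ symbNorm |s| P.p0 * (ENNReal.ofReal ((2 : ℝ) ^ (|s| / 2)) * eNorm (s + 1) u) := by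
    calc eNorm s (conv P.p0 u) ≤ ENNReal.ofReal ((2 : ℝ) ^ (|s| / 2)) * symbNorm |s| P.p0 * eNorm s u :=
          eNorm_conv_le s _ _
      _ ≤ ENNReal.ofReal ((2 : ℝ) ^ (|s| / 2)) * symbNorm |s| P.p0 * eNorm (s + 1) u := mul_le_mul' le_rfl h0
      _ = _ := by ring
  have hA' : eNorm s (fun k => ∑ j, P.P j (freqDeriv j u k)) ≤
      (∑ j, ‖P.P j‖ₑ) * (ENNReal.ofReal (2 * Real.pi) * eNorm (s + 1) u) := by
    have heq : (fun k => ∑ j, P.P j (freqDeriv j u k)) = ∑ j, fun k => P.P j (freqDeriv j u k) := by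
      funext k; simp [Finset.sum_apply]
    rw [heq, Finset.sum_mul]
    exact (eNorm_sum_le s _ _).trans (Finset.sum_le_sum fun j _ => hA j)
  have hB' : eNorm s (∑ j, conv (P.p j) (freqDeriv j u)) ≤ (∑ j, symbNorm |s| (P.p j)) *
      (ENNReal.ofReal ((2 : ℝ) ^ (|s| / 2)) * ENNReal.ofReal (2 * Real.pi) * eNorm (s + 1) u) := by
    rw [Finset.sum_mul]
    exact (eNorm_sum_le s _ _).trans (Finset.sum_le_sum fun j _ => hB j)
  have hsplit : eNorm s (P.apply u) ≤ eNorm s (fun k => ∑ j, P.P j (freqDeriv j u k)) +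
      eNorm s (∑ j, conv (P.p j) (freqDeriv j u)) + eNorm s (conv P.p0 u) :=
    calc eNorm s (P.apply u) = eNorm s ((fun k => ∑ j, P.P j (freqDeriv j u k)) +
          ∑ j, conv (P.p j) (freqDeriv j u) + conv P.p0 u) := by rw [apply_def]
      _ ≤ _ := (eNorm_add_le s _ (conv P.p0 u)).trans (add_le_add (eNorm_add_le s _ _) le_rfl)
  refine hsplit.trans ((add_le_add (add_le_add hA' hB') hC).trans (le_of_eq ?_))
  rw [bound]
  ring

omit [CompleteSpace W] in
/-- `P u ∈ H_s` for `u ∈ H_{s+1}`. [cite: WarnerGTM94, Prop. 6.25 (2)] -/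
theorem eNormSq_apply_lt_top {s : ℝ} {u : (d → ℤ) → V} (hu : eNormSq (s + 1) u < ∞) :
    eNormSq s (P.apply u) < ∞ := by
  rw [← eNorm_lt_top_iff] at hu ⊢
  exact (P.eNorm_apply_le s u).trans_lt (ENNReal.mul_lt_top (P.bound_lt_top s) hu)

/-- `P (u + v) = P u + P v` for tempered `u, v`. [folklore] -/
theorem apply_add {u v : (d → ℤ) → V} (hu : Tempered u) (hv : Tempered v) :
    P.apply (u + v) = P.apply u + P.apply v := by
  have h1 : ∀ j, conv (P.p j) (freqDeriv j u + freqDeriv j v) =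
      conv (P.p j) (freqDeriv j u) + conv (P.p j) (freqDeriv j v) := fun j =>
    conv_add (P.hp j) (hu.freqDeriv j) (hv.freqDeriv j)
  rw [apply_def, apply_def, apply_def]
  funext k
  simp only [Pi.add_apply, Finset.sum_apply, freqDeriv_add, conv_add P.hp0 hu hv, h1, map_add,
    Finset.sum_add_distrib]
  abel

omit [CompleteSpace W] in
/-- `P (z • u) = z • P u` (unconditionally). [folklore] -/
theorem apply_smul (z : ℂ) (u : (d → ℤ) → V) : P.apply (z • u) = z • P.apply u := by
  rw [apply_def, apply_def]
  funext k
  simp only [Pi.add_apply, Pi.smul_apply, Finset.sum_apply, freqDeriv_const_smul, conv_const_smul,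
    map_smul, smul_add, Finset.smul_sum]

/-- `P (u - v) = P u - P v` for tempered `u, v`. [folklore] -/
theorem apply_sub {u v : (d → ℤ) → V} (hu : Tempered u) (hv : Tempered v) :
    P.apply (u - v) = P.apply u - P.apply v := by
  rw [sub_eq_add_neg, P.apply_add hu hv.neg, show -v = (-1 : ℂ) • v by simp, P.apply_smul]
  simp [sub_eq_add_neg]

end POp1

end Lattice

end Literature.Analysis.FunctionSpaces
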